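import Summits.AnomalousDissipation.AnomalousDissipation.Theorems.DenseLoudDesignerForces.Negative.PowerBudget
import Literature.Analysis.FluidPDE.AlexakisDoeringProofs
import Literature.Analysis.FluidPDE.NSEnstrophyBalance2DProofs

/-!
# Negative knowledge for the crux `DenseLoudDesignerForces` (stmt-AnomalousDissipation-1143), X: the planar
# analogue of the crux is FALSE (dimensional load; Alexakis–Doering)

Certified copy of §12 of the cdisprove work file (generation 3).  `DenseLoudDesignerForcesPlanar` — the crux
verbatim with `T³, ℝ³, ℤ³` replaced by `T², ℝ², ℤ²` (planar steady trig-poly designer forces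
`f_c = Re ∑ e_k P_k ĉ_k`, planar `τ`-periodic classical witnesses, the same budgets, levels and windows) — is
FALSE for every stock, all budgets and every window (`denseLoudDesignerForces_false_planar`).  Mechanism, all of
it discharged in the tree: a periodic classical solution of 2-D NS_ν is a global Leray–Hopf solution from its
smooth time-zero slice (`IsClassicalNSSolutionOn.isGlobalLerayHopf`); the two-dimensional ENSTROPHY BALANCE
(`fmrt_enstrophy_balance_torus2_holds`, Foias–Manley–Rosa–Temam 2001 Thm. 7.4/(A.65)) bounds the enstrophy
dissipation, `χ ≤ ‖Δf_c‖_∞ U` (`meanEnstrophyDissipation_le_of_enstrophyBalance`, Alexakis–Doering 2006 (VBI)),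
and the interpolation `ε² ≤ ν U² χ` (`meanDissipation_sq_le_of_enstrophyBalance`, op. cit. (trickI)) gives
`ε² ≤ ν Λ₂(c) U³` for every planar periodic orbit (`Planar.meanDissipation_sq_le_alexakisDoering`; the case
`U = 0` is the planar power budget), whence the PLANAR LEVEL SHELL `ε² ≤ Λ₂(c) E√E/(j+1)`
(`Planar.planar_shell`), uniformly small on bounded coefficient sets.  READING: the loudness asked by the crux
(mean enstrophy `≥ ε/ν`, WitnessAnatomy) must be produced by VORTEX STRETCHING; with the enstrophy budget closed
it is unreachable.  Third exactly-solvable witness sub-family certified empty at large levels (after the linear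
one, FalseWithoutConvection, and the band-limited one, BandLimited).  Supports stmt-AnomalousDissipation-1143.
-/

noncomputable section

namespace Summit.AnomalousDissipation.AnomalousDissipation.Theorems.DenseLoudDesignerForces.Negative

open scoped BigOperators Topology ENNReal InnerProductSpace
open Filter Set MeasureTheory UnitAddTorus
open Literature.Analysis.FunctionSpaces Literature.Analysis.FluidPDE
open Summit.AnomalousDissipation.AnomalousDissipation.Theses.BaireTransfer

/-! ## §12 Refuted strengthening / dimensional load: the PLANAR (`d = 2`) analogue of the crux is FALSE -/

namespace Planar

/-- The planar designer force `f_c = realTrigPoly S (k ↦ P_k ĉ_k)` on `T²` (the crux's force term with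
`Fin 3` replaced by `Fin 2`). -/
def force (S : Finset (Fin 2 → ℤ)) (c : ↥S → (EuclideanSpace ℂ (Fin 2))) : (UnitAddTorus (Fin 2)) → (EuclideanSpace ℝ (Fin 2)) :=
  Torus.realTrigPoly S (fun k => Torus.lerayCoeff k (Torus.coeffExt S c k))

/-- The PLANAR LOUD SET `pLOUD_j(S,E,ε)`: the crux's set-builder verbatim on `T²`. -/
def loudSet (S : Finset (Fin 2 → ℤ)) (E ε : ℝ) (j : ℕ) : Set (↥S → (EuclideanSpace ℂ (Fin 2))) :=
  {c : ↥S → (EuclideanSpace ℂ (Fin 2)) | ∃ ν : ℝ, 0 < ν ∧ ν < 1 / ((j : ℝ) + 1) ∧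
    ∃ (τ : ℝ) (u : ℝ → (UnitAddTorus (Fin 2)) → (EuclideanSpace ℝ (Fin 2))) (p : ℝ → (UnitAddTorus (Fin 2)) → ℝ), 0 < τ ∧
      Torus.IsClassicalNSSolutionOn Set.univ ν (fun _ => force S c) u p ∧
      Function.Periodic u τ ∧ meanEnergy u ≤ E ∧ ε ≤ meanDissipation ν u}

/-- The planar designer force is smooth. -/
theorem isSmooth_force (S : Finset (Fin 2 → ℤ)) (c : ↥S → (EuclideanSpace ℂ (Fin 2))) : Torus.IsSmooth (force S c) :=
  Torus.isSmooth_realTrigPoly S _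

/-- The planar designer force is divergence free (transversality of the Leray multiplier). -/
theorem isDivFree_force (S : Finset (Fin 2 → ℤ)) (c : ↥S → (EuclideanSpace ℂ (Fin 2))) : Torus.IsDivFree (force S c) := by
  refine Torus.isDivFree_realTrigPoly fun k _ => ?_
  by_cases hk : k = 0
  · subst hk; simp
  · rw [Torus.lerayCoeff_of_ne_zero hk]; exact Torus.sum_mul_leraySym_apply k _

/-- The planar designer force has zero mean (the Leray multiplier kills the zero mode). -/
theorem hasZeroMean_force (S : Finset (Fin 2 → ℤ)) (c : ↥S → (EuclideanSpace ℂ (Fin 2))) : Torus.HasZeroMean (force S c) := by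
  set g : (Fin 2 → ℤ) → (EuclideanSpace ℂ (Fin 2)) := fun k => Torus.lerayCoeff k (Torus.coeffExt S c k) with hg
  have hg0 : g 0 = 0 := by simp [hg]
  show ∫ x, EuclideanSpace.realPart (Torus.trigPoly S g x) = 0
  rw [EuclideanSpace.realPart.integral_comp_comm (Torus.continuous_trigPoly S g).integrable_unitAddTorus]
  have h : ∫ x, Torus.trigPoly S g x = 0 := by
    simp_rw [Torus.trigPoly_apply]
    have hint : ∀ k ∈ S, Integrable (fun x : (UnitAddTorus (Fin 2)) => mFourier k x • g k) volume :=
      fun k _ => ((mFourier k).continuous.smul continuous_const).integrable_unitAddTorus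
    rw [integral_finsetSum _ hint]
    refine Finset.sum_eq_zero fun k _ => ?_
    rw [integral_smul_const, Torus.integral_mFourier]
    by_cases hk0 : k = 0
    · subst hk0; rw [hg0, smul_zero]
    · rw [if_neg hk0, zero_smul]
  rw [h, map_zero]

/-- The Leray multiplier is a contraction on coefficients. -/
theorem norm_lerayCoeff_le (k : Fin 2 → ℤ) (c : (EuclideanSpace ℂ (Fin 2))) : ‖Torus.lerayCoeff k c‖ ≤ ‖c‖ := by
  by_cases hk : k = 0
  · subst hk; simp
  · rw [Torus.lerayCoeff_of_ne_zero hk]; exact Torus.norm_leraySym_le k c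

/-- The coordinatewise real part is a contraction. -/
theorem norm_realPart_le (w : (EuclideanSpace ℂ (Fin 2))) : ‖EuclideanSpace.realPart w‖ ≤ ‖w‖ := by
  rw [EuclideanSpace.norm_eq, EuclideanSpace.norm_eq]
  gcongr with i
  simp only [EuclideanSpace.realPart_apply, Real.norm_eq_abs]
  exact Complex.abs_re_le_norm (w i)

/-- Sup bound for a vector trigonometric polynomial. -/
theorem norm_trigPoly_apply_le (S : Finset (Fin 2 → ℤ)) (g : (Fin 2 → ℤ) → (EuclideanSpace ℂ (Fin 2))) (x : (UnitAddTorus (Fin 2))) :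
    ‖Torus.trigPoly S g x‖ ≤ ∑ k ∈ S, ‖g k‖ := by
  rw [Torus.trigPoly_apply]
  refine (norm_sum_le _ _).trans (Finset.sum_le_sum fun k _ => ?_)
  rw [norm_smul]
  calc ‖mFourier k x‖ * ‖g k‖ ≤ 1 * ‖g k‖ :=
        mul_le_mul_of_nonneg_right (((mFourier k).norm_coe_le_norm x).trans_eq mFourier_norm) (norm_nonneg _)
    _ = ‖g k‖ := one_mul _

/-- The planar LAPLACIAN BOUND `Λ₂(c) = ∑ᵢ ∑_{k∈S} (2π kᵢ)² ‖c k‖ ≥ ‖Δf_c‖_∞`. -/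
def lapBound (S : Finset (Fin 2 → ℤ)) (c : ↥S → (EuclideanSpace ℂ (Fin 2))) : ℝ :=
  ∑ i : Fin 2, ∑ k : ↥S, (2 * Real.pi * |(((k : Fin 2 → ℤ) i : ℤ) : ℝ)|) ^ 2 * ‖c k‖

/-- `0 ≤ Λ₂(c)`. -/
theorem lapBound_nonneg (S : Finset (Fin 2 → ℤ)) (c : ↥S → (EuclideanSpace ℂ (Fin 2))) : 0 ≤ lapBound S c :=
  Finset.sum_nonneg fun _ _ => Finset.sum_nonneg fun _ _ => by positivity

/-- `Λ₂(c) ≤ Λ₂(S) ‖c‖`. -/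
theorem lapBound_le (S : Finset (Fin 2 → ℤ)) (c : ↥S → (EuclideanSpace ℂ (Fin 2))) :
    lapBound S c ≤ (∑ i : Fin 2, ∑ k : ↥S, (2 * Real.pi * |(((k : Fin 2 → ℤ) i : ℤ) : ℝ)|) ^ 2) * ‖c‖ := by
  unfold lapBound
  rw [Finset.sum_mul]
  refine Finset.sum_le_sum fun i _ => ?_
  rw [Finset.sum_mul]
  refine Finset.sum_le_sum fun k _ => ?_
  gcongr
  exact norm_le_pi_norm c k

/-- `‖Δ f_c(x)‖ ≤ Λ₂(c)` pointwise on `T²`. -/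
theorem norm_laplacian_force_le (S : Finset (Fin 2 → ℤ)) (c : ↥S → (EuclideanSpace ℂ (Fin 2))) (x : (UnitAddTorus (Fin 2))) :
    ‖Torus.laplacian (force S c) x‖ ≤ lapBound S c := by
  rw [Torus.laplacian_eq_sum_partialDeriv_partialDeriv (isSmooth_force S c)]
  refine (norm_sum_le _ _).trans ?_
  unfold lapBound
  refine Finset.sum_le_sum fun i _ => ?_
  unfold force
  rw [Torus.partialDeriv_realTrigPoly', Torus.partialDeriv_realTrigPoly, Torus.realTrigPoly_apply]
  refine (norm_realPart_le _).trans ((norm_trigPoly_apply_le S _ x).trans ?_)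
  rw [← Finset.sum_coe_sort]
  refine Finset.sum_le_sum fun k _ => ?_
  rw [norm_smul, norm_smul, Torus.coeffExt_coe]
  have h1 : ‖(2 * Real.pi * Complex.I * ((k : Fin 2 → ℤ) i : ℂ))‖ = 2 * Real.pi * |(((k : Fin 2 → ℤ) i : ℤ) : ℝ)| := by
    rw [norm_mul, norm_mul, norm_mul, Complex.norm_I, mul_one, Complex.norm_intCast, Complex.norm_ofNat,
      Complex.norm_real, Real.norm_eq_abs, abs_of_pos Real.pi_pos]
  rw [h1, ← mul_assoc, ← sq]
  gcongr
  exact norm_lerayCoeff_le _ _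

end Planar

/-! ### The power budget of a periodic classical orbit in any dimension (period means on `T^d`)

The `T³` versions live in `Negative.PowerBudget`; these are the dimension-generic twins (suffix `_dim`), used
below at `d = Fin 2`. -/

section PowerBudgetDim

variable {d : Type*} [Fintype d] [DecidableEq d]
variable {ν τ : ℝ} {F : UnitAddTorus d → EuclideanSpace ℝ d} {u : ℝ → UnitAddTorus d → EuclideanSpace ℝ d}
  {p : ℝ → UnitAddTorus d → ℝ}

/-- Energy equality over one period on `T^d`: `ν ∫₀^τ ‖∇u‖₂² = ∫₀^τ ∫⟪F, u⟫`. -/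
theorem period_dissipation_eq_power_dim (h : Torus.IsClassicalNSSolutionOn univ ν (fun _ => F) u p)
    (hper : Function.Periodic u τ) (hτ : 0 < τ) :
    ν * ∫ t in (0 : ℝ)..τ, Torus.gradNormSq (u t) = ∫ t in (0 : ℝ)..τ, ∫ x, ⟪F x, u t x⟫_ℝ := by
  have hE := h.energy_eq convex_univ hτ.le (subset_univ _)
  have h0 : u τ = u 0 := by simpa using hper 0
  rw [h0] at hE
  linarith

/-- On `T^d`: the mean dissipation of a periodic smooth field is the period mean of `ν‖∇u‖₂²`. -/
theorem meanDissipation_eq_period_mean_dim (hu : Torus.IsSmoothSpaceTimeOn univ u)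
    (hper : Function.Periodic u τ) (hτ : 0 < τ) :
    meanDissipation ν u = τ⁻¹ * (ν * ∫ t in (0 : ℝ)..τ, Torus.gradNormSq (u t)) := by
  rw [meanDissipation_eq_of_periodic hper hτ]
  congr 1
  rw [← intervalIntegral.integral_const_mul]
  refine intervalIntegral.integral_congr fun t _ => ?_
  rw [Torus.gradNormSq_eq_toReal_eGradNormSq_holds (hu.isSmooth_slice (mem_univ t))]

/-- On `T^d`: mean dissipation = mean power input. -/
theorem meanDissipation_eq_meanPower_dim (h : Torus.IsClassicalNSSolutionOn univ ν (fun _ => F) u p)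
    (hper : Function.Periodic u τ) (hτ : 0 < τ) :
    meanDissipation ν u = τ⁻¹ * ∫ t in (0 : ℝ)..τ, ∫ x, ⟪F x, u t x⟫_ℝ := by
  rw [meanDissipation_eq_period_mean_dim h.smooth_velocity hper hτ, period_dissipation_eq_power_dim h hper hτ]

omit [DecidableEq d] in
/-- On `T^d`: the mean energy of a periodic orbit is nonnegative. -/
theorem meanEnergy_nonneg_dim (hper : Function.Periodic u τ) (hτ : 0 < τ) : 0 ≤ meanEnergy u := by
  rw [meanEnergy_eq_of_periodic hper hτ]
  refine mul_nonneg (inv_nonneg.2 hτ.le) ?_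
  exact intervalIntegral.integral_nonneg hτ.le fun t _ => integral_nonneg fun _ => sq_nonneg _

omit [DecidableEq d] in
/-- POWER BUDGET CORE (any dimension): `D² ≤ (∫‖F‖²)·⟨‖u‖²⟩` for the period-mean power `D ≥ 0` of a smooth steady
field `F` against a jointly smooth `τ`-periodic field `u` on `T^d`. -/
theorem power_budget_core_dim (hu : Torus.IsSmoothSpaceTimeOn univ u) (hF : Torus.IsSmooth F)
    (hper : Function.Periodic u τ) (hτ : 0 < τ) {D : ℝ} (hD : 0 ≤ D)
    (hDeq : D = τ⁻¹ * ∫ t in (0 : ℝ)..τ, ∫ x, ⟪F x, u t x⟫_ℝ) :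
    D ^ 2 ≤ (∫ x, ‖F x‖ ^ 2) * meanEnergy u := by
  set A : ℝ := ∫ x, ‖F x‖ ^ 2 with hAdef
  have hA : 0 ≤ A := integral_nonneg fun _ => sq_nonneg _
  have he_st : Torus.IsSmoothSpaceTimeOn univ (fun t x => ‖u t x‖ ^ 2) := by
    change ContDiffOn ℝ _ (fun z => ‖Torus.stLift u z‖ ^ 2) _
    exact hu.norm_sq ℝ
  have he_cont : Continuous fun t => ∫ x, ‖u t x‖ ^ 2 :=
    continuousOn_univ.1 (he_st.continuousOn_integral convex_univ)
  have hB : 0 ≤ meanEnergy u := meanEnergy_nonneg_dim hper hτ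
  have hP_st : Torus.IsSmoothSpaceTimeOn univ (fun t x => ⟪F x, u t x⟫_ℝ) :=
    (Torus.isSmoothSpaceTimeOn_const hF univ).inner hu
  have hP_cont : Continuous fun t => ∫ x, ⟪F x, u t x⟫_ℝ :=
    continuousOn_univ.1 (hP_st.continuousOn_integral convex_univ)
  refine sq_le_mul_of_forall_weighted hA hB hD fun lam hl => ?_
  have hspace : ∀ t, 2 * ∫ x, ⟪F x, u t x⟫_ℝ ≤ lam * A + (∫ x, ‖u t x‖ ^ 2) / lam := by
    intro t
    have hut : Torus.IsSmooth (u t) := hu.isSmooth_slice (mem_univ t)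
    have hint1 : Integrable (fun x => ⟪F x, u t x⟫_ℝ) := (hF.inner hut).integrable
    have hint2 : Integrable (fun x => lam * ‖F x‖ ^ 2 + ‖u t x‖ ^ 2 / lam) :=
      ((hF.norm_sq.integrable).const_mul lam).add (hut.norm_sq.integrable.div_const lam)
    have hpt : ∀ x, 2 * ⟪F x, u t x⟫_ℝ ≤ lam * ‖F x‖ ^ 2 + ‖u t x‖ ^ 2 / lam := fun x =>
      (mul_le_mul_of_nonneg_left (real_inner_le_norm _ _) zero_le_two).trans (two_mul_le_weighted hl)
    calc 2 * ∫ x, ⟪F x, u t x⟫_ℝ = ∫ x, 2 * ⟪F x, u t x⟫_ℝ := (integral_const_mul _ _).symm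
      _ ≤ ∫ x, (lam * ‖F x‖ ^ 2 + ‖u t x‖ ^ 2 / lam) :=
          integral_mono (hint1.const_mul 2) hint2 hpt
      _ = lam * A + (∫ x, ‖u t x‖ ^ 2) / lam := by
          rw [integral_add ((hF.norm_sq.integrable).const_mul lam) (hut.norm_sq.integrable.div_const lam),
            integral_const_mul, integral_div]
  have htime : 2 * ∫ t in (0 : ℝ)..τ, ∫ x, ⟪F x, u t x⟫_ℝ ≤
      τ * (lam * A) + (∫ t in (0 : ℝ)..τ, ∫ x, ‖u t x‖ ^ 2) / lam := by
    have hi1 : IntervalIntegrable (fun t => ∫ x, ⟪F x, u t x⟫_ℝ) volume 0 τ :=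
      hP_cont.intervalIntegrable _ _
    have hi2 : IntervalIntegrable (fun t => lam * A + (∫ x, ‖u t x‖ ^ 2) / lam) volume 0 τ :=
      (continuous_const.add (he_cont.div_const lam)).intervalIntegrable _ _
    calc 2 * ∫ t in (0 : ℝ)..τ, ∫ x, ⟪F x, u t x⟫_ℝ
        = ∫ t in (0 : ℝ)..τ, 2 * ∫ x, ⟪F x, u t x⟫_ℝ := (intervalIntegral.integral_const_mul _ _).symm
      _ ≤ ∫ t in (0 : ℝ)..τ, (lam * A + (∫ x, ‖u t x‖ ^ 2) / lam) :=
          intervalIntegral.integral_mono_on hτ.le (hi1.const_mul 2) hi2 fun t _ => hspace t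
      _ = τ * (lam * A) + (∫ t in (0 : ℝ)..τ, ∫ x, ‖u t x‖ ^ 2) / lam := by
          rw [intervalIntegral.integral_add intervalIntegrable_const (he_cont.intervalIntegrable _ _ |>.div_const lam),
            intervalIntegral.integral_const, intervalIntegral.integral_div]
          simp
  rw [hDeq, meanEnergy_eq_of_periodic hper hτ]
  have hτinv : 0 < τ⁻¹ := inv_pos.2 hτ
  calc 2 * (τ⁻¹ * ∫ t in (0 : ℝ)..τ, ∫ x, ⟪F x, u t x⟫_ℝ)
      = τ⁻¹ * (2 * ∫ t in (0 : ℝ)..τ, ∫ x, ⟪F x, u t x⟫_ℝ) := by ring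
    _ ≤ τ⁻¹ * (τ * (lam * A) + (∫ t in (0 : ℝ)..τ, ∫ x, ‖u t x‖ ^ 2) / lam) :=
        mul_le_mul_of_nonneg_left htime hτinv.le
    _ = lam * A + (τ⁻¹ * ∫ t in (0 : ℝ)..τ, ∫ x, ‖u t x‖ ^ 2) / lam := by
        field_simp

/-- POWER BUDGET (any dimension): `meanDissipation² ≤ ‖F‖²_{L²} · meanEnergy` for periodic classical orbits on `T^d`. -/
theorem meanDissipation_sq_le_dim (h : Torus.IsClassicalNSSolutionOn univ ν (fun _ => F) u p)
    (hF : Torus.IsSmooth F) (hν : 0 ≤ ν) (hper : Function.Periodic u τ) (hτ : 0 < τ) :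
    meanDissipation ν u ^ 2 ≤ (∫ x, ‖F x‖ ^ 2) * meanEnergy u := by
  have hD : 0 ≤ meanDissipation ν u := by
    rw [meanDissipation_eq_period_mean_dim h.smooth_velocity hper hτ]
    refine mul_nonneg (inv_nonneg.2 hτ.le) (mul_nonneg hν ?_)
    exact intervalIntegral.integral_nonneg hτ.le fun t _ => Torus.gradNormSq_nonneg _
  exact power_budget_core_dim h.smooth_velocity hF hper hτ hD (meanDissipation_eq_meanPower_dim h hper hτ)

/-- On `T^d`: the mean dissipation of a periodic classical orbit is nonnegative. -/
theorem meanDissipation_nonneg_dim (h : Torus.IsClassicalNSSolutionOn univ ν (fun _ => F) u p)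
    (hν : 0 ≤ ν) (hper : Function.Periodic u τ) (hτ : 0 < τ) : 0 ≤ meanDissipation ν u := by
  rw [meanDissipation_eq_period_mean_dim h.smooth_velocity hper hτ]
  refine mul_nonneg (inv_nonneg.2 hτ.le) (mul_nonneg hν ?_)
  exact intervalIntegral.integral_nonneg hτ.le fun t _ => Torus.gradNormSq_nonneg _

end PowerBudgetDim

namespace Planar

/-! ### The Alexakis–Doering shell and the planar kill -/

variable {S : Finset (Fin 2 → ℤ)} {E ε ν τ : ℝ} {u : ℝ → (UnitAddTorus (Fin 2)) → (EuclideanSpace ℝ (Fin 2))}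
  {p : ℝ → (UnitAddTorus (Fin 2)) → ℝ}

/-- ALEXAKIS–DOERING BOUND FOR A PLANAR PERIODIC ORBIT: a `τ`-periodic classical solution of 2-D NS_ν
(`ν > 0`) forced by the designer force `f_c` satisfies `⟨ν‖∇u‖²⟩² ≤ ν · Λ₂(c) · ⟨‖u‖²⟩ · ⟨‖u‖²⟩^{1/2}`
(`χ ≤ ‖Δf_c‖_∞ U` by the enstrophy balance — no vortex stretching — and `ε² ≤ ν U² χ`). -/
theorem meanDissipation_sq_le_alexakisDoering {c : ↥S → (EuclideanSpace ℂ (Fin 2))} (hν : 0 < ν)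
    (h : Torus.IsClassicalNSSolutionOn univ ν (fun _ => force S c) u p)
    (hper : Function.Periodic u τ) (hτ : 0 < τ) :
    meanDissipation ν u ^ 2 ≤ ν * lapBound S c * (meanEnergy u * Real.sqrt (meanEnergy u)) := by
  have hLH : Torus.IsGlobalLerayHopf ν (fun _ => force S c) (u 0) u := h.isGlobalLerayHopf
  have hu0 : Torus.IsSmooth (u 0) := h.smooth_velocity.isSmooth_slice (mem_univ 0)
  have hmE : 0 ≤ meanEnergy u := meanEnergy_nonneg_dim hper hτ
  have hU_eq : rmsVelocity longTimeAvgSup u = Real.sqrt (meanEnergy u) := rfl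
  have hU2 : rmsVelocity longTimeAvgSup u ^ 2 = meanEnergy u := by rw [hU_eq, Real.sq_sqrt hmE]
  have hK := lapBound_nonneg S c
  by_cases hUpos : 0 < rmsVelocity longTimeAvgSup u
  · have hχ := meanEnstrophyDissipation_le_of_enstrophyBalance fmrt_enstrophy_balance_torus2_holds hν
      (isSmooth_force S c) (isDivFree_force S c) (hasZeroMean_force S c) hK (norm_laplacian_force_le S c)
      hu0 hLH hUpos
    have hεsq := meanDissipation_sq_le_of_enstrophyBalance fmrt_enstrophy_balance_torus2_holds hν
      (isSmooth_force S c) (isDivFree_force S c) (hasZeroMean_force S c) hu0 hLH hUpos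
    calc meanDissipation ν u ^ 2
        ≤ ν * rmsVelocity longTimeAvgSup u ^ 2 * meanEnstrophyDissipation ν u := hεsq
      _ ≤ ν * rmsVelocity longTimeAvgSup u ^ 2 * (lapBound S c * rmsVelocity longTimeAvgSup u) := by
          gcongr
      _ = ν * lapBound S c * (meanEnergy u * Real.sqrt (meanEnergy u)) := by
          rw [hU2, hU_eq]; ring
  · -- `U = 0`: the orbit has zero mean energy, hence zero mean dissipation by the power budget
    have hU0 : rmsVelocity longTimeAvgSup u = 0 :=
      le_antisymm (not_lt.1 hUpos) (by rw [hU_eq]; exact Real.sqrt_nonneg _)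
    have hE0 : meanEnergy u = 0 := by rw [← hU2, hU0]; ring
    have hpow := meanDissipation_sq_le_dim h (isSmooth_force S c) hν.le hper hτ
    rw [hE0, mul_zero] at hpow
    rw [hE0, Real.sqrt_zero, mul_zero, mul_zero]
    exact hpow

/-- PLANAR LEVEL SHELL: `c ∈ pLOUD_j(S,E,ε)`, `0 ≤ ε` ⇒ `0 ≤ E` and `ε² ≤ Λ₂(c) E √E/(j+1)` — uniformly
small on bounded coefficient sets as `j → ∞`. -/
theorem planar_shell (hε : 0 ≤ ε) {j : ℕ} {c : ↥S → (EuclideanSpace ℂ (Fin 2))} (hc : c ∈ loudSet S E ε j) :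
    0 ≤ E ∧ ε ^ 2 ≤ lapBound S c * (E * Real.sqrt E) / ((j : ℝ) + 1) := by
  obtain ⟨ν, hν, hνj, τ, u, p, hτ, hsol, hper, hEu, hεu⟩ := hc
  have hmE := meanEnergy_nonneg_dim hper hτ
  have hE : 0 ≤ E := hmE.trans hEu
  refine ⟨hE, ?_⟩
  have hj : (0 : ℝ) < (j : ℝ) + 1 := by positivity
  have hK := lapBound_nonneg S c
  have hAD := meanDissipation_sq_le_alexakisDoering hν hsol hper hτ
  have h1 : meanEnergy u * Real.sqrt (meanEnergy u) ≤ E * Real.sqrt E :=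
    mul_le_mul hEu (Real.sqrt_le_sqrt hEu) (Real.sqrt_nonneg _) hE
  have hES : 0 ≤ E * Real.sqrt E := mul_nonneg hE (Real.sqrt_nonneg _)
  rw [le_div_iff₀ hj]
  have hνj' : ν * ((j : ℝ) + 1) ≤ 1 := by
    have := hνj.le; rwa [le_div_iff₀ hj] at this
  calc ε ^ 2 * ((j : ℝ) + 1) ≤ meanDissipation ν u ^ 2 * ((j : ℝ) + 1) := by gcongr
    _ ≤ ν * lapBound S c * (meanEnergy u * Real.sqrt (meanEnergy u)) * ((j : ℝ) + 1) := by gcongr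
    _ ≤ ν * lapBound S c * (E * Real.sqrt E) * ((j : ℝ) + 1) := by gcongr
    _ = (ν * ((j : ℝ) + 1)) * (lapBound S c * (E * Real.sqrt E)) := by ring
    _ ≤ 1 * (lapBound S c * (E * Real.sqrt E)) := by gcongr
    _ = lapBound S c * (E * Real.sqrt E) := one_mul _

end Planar

/-- `DenseLoudDesignerForces` IN THE PLANE: the crux verbatim with `T³`, `ℝ³`, `ℤ³` replaced by `T²`, `ℝ²`,
`ℤ²` (planar steady trig-poly designer forces, planar periodic classical witnesses). -/
def DenseLoudDesignerForcesPlanar : Prop :=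
  ∀ S₀ : Finset (Fin 2 → ℤ), ∃ S : Finset (Fin 2 → ℤ), S₀ ⊆ S ∧ ∃ (E ε : ℝ), 0 < ε ∧
    ∃ U : Set (↥S → EuclideanSpace ℂ (Fin 2)), IsOpen U ∧ U.Nonempty ∧
      ∀ j : ℕ, U ⊆ closure (Planar.loudSet S E ε j)

/-- REFUTED STRENGTHENING / DIMENSIONAL LOAD: THE PLANAR ANALOGUE OF THE CRUX IS FALSE (Alexakis–Doering):
for EVERY stock, all budgets and every open non-empty `U ⊆ P_S`, the planar loud sets fail to be dense in `U`
at all large levels — `pLOUD_j ∩ B = ∅` for every bounded `B` once `(j+1)ε² > Λ₂(S)(sup_B‖c‖) E√E`.  Any proof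
of the crux must use the third dimension (vortex stretching): in the plane the enstrophy budget closes and
`ε ≤ (ν Λ₂(c))^{1/2} E^{3/4} → 0` uniformly on bounded force sets. -/
theorem denseLoudDesignerForces_false_planar : ¬ DenseLoudDesignerForcesPlanar := by
  intro h
  obtain ⟨S, -, E, ε, hε, U, hU, ⟨c, hc⟩, hW⟩ := h ∅
  set L2 : ℝ := ∑ i : Fin 2, ∑ k : ↥S, (2 * Real.pi * |(((k : Fin 2 → ℤ) i : ℤ) : ℝ)|) ^ 2 with hL2
  have hL2n : 0 ≤ L2 := Finset.sum_nonneg fun _ _ => Finset.sum_nonneg fun _ _ => by positivity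
  set C : ℝ := L2 * (‖c‖ + 1) with hC
  have hCn : 0 ≤ C := by positivity
  have hnear : ∀ j : ℕ, ∃ c' ∈ Planar.loudSet S E ε j, dist c' c < 1 := by
    intro j
    obtain ⟨c', hc', hd⟩ := Metric.mem_closure_iff.1 (hW j hc) 1 one_pos
    exact ⟨c', hc', by rwa [dist_comm]⟩
  have hlevel : ∀ j : ℕ, 0 ≤ E ∧ ε ^ 2 ≤ C * (E * Real.sqrt E) / ((j : ℝ) + 1) := by
    intro j
    obtain ⟨c', hc', hd⟩ := hnear j
    obtain ⟨hE, hsh⟩ := Planar.planar_shell hε.le hc'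
    refine ⟨hE, hsh.trans ?_⟩
    have hn : ‖c'‖ ≤ ‖c‖ + 1 := by
      calc ‖c'‖ ≤ ‖c‖ + ‖c' - c‖ := norm_le_norm_add_norm_sub' c' c
        _ ≤ ‖c‖ + 1 := by rw [← dist_eq_norm]; linarith
    have hlap : Planar.lapBound S c' ≤ C := (Planar.lapBound_le S c').trans (mul_le_mul_of_nonneg_left hn hL2n)
    have hj : (0 : ℝ) < (j : ℝ) + 1 := by positivity
    have hES : 0 ≤ E * Real.sqrt E := mul_nonneg hE (Real.sqrt_nonneg _)
    gcongr
  have hE := (hlevel 0).1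
  have hES : 0 ≤ E * Real.sqrt E := mul_nonneg hE (Real.sqrt_nonneg _)
  have hsq : ε ^ 2 ≤ 0 := by
    refine le_of_forall_pos_le_add fun δ hδ => ?_
    obtain ⟨j, hj⟩ := exists_nat_gt (C * (E * Real.sqrt E) / δ)
    have h1 := (hlevel j).2
    have hj1 : (0 : ℝ) < (j : ℝ) + 1 := by positivity
    have hK : C * (E * Real.sqrt E) / ((j : ℝ) + 1) ≤ δ := by
      rw [div_le_iff₀ hj1]
      have h2 : C * (E * Real.sqrt E) / δ < (j : ℝ) + 1 := hj.trans (lt_add_one _)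
      rw [div_lt_iff₀ hδ] at h2
      linarith
    linarith
  nlinarith

end Summit.AnomalousDissipation.AnomalousDissipation.Theorems.DenseLoudDesignerForces.Negative

end
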